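import Summits.Ventures.Crystal3D.StickySpheres.FiveRing
import Summits.Ventures.Crystal3D.StickySpheres.ObstructionPatterns
import HarnessLib

/-!
# The pattern `Open8B` (pentagonal dipyramid plus one ball) is not realisable

Venture `Crystal3D` (cell `pub-crystal3d`, seat p2). One of the three `K₄`-free patterns of the `(8,18)` obstruction set
(`ineq/FORMAL-C9.md` §3, §7) for which the linear Positivstellensatz search found no certificate. Graph6 `GCxu~w`: two
apexes `N, S` touching the five balls `r₀, …, r₄` of a ring (consecutive ring balls touching), and an eighth ball `X`
touching `N` and the two non-adjacent ring balls `r₀, r₂`.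

Proof WITHOUT angles or coordinates (the method of `FiveRing.lean`). The vectors `v_i = r_i − (N+S)/2` are orthogonal to
`S − N` and have the same squared length `ρ²`; consecutive ones have inner product `c = ρ² − 1/2`. Three vectors orthogonal
to a non-zero vector are linearly dependent (`exists_rel_of_orthogonal`), which for points of a circle gives the REFLECTION
RULE `ρ² (v_{i−1} + v_{i+1}) = 2c · v_i` whenever `r_{i−1} ≠ r_{i+1}` (`smul_add_eq_smul_of_circle`). Hence
`ρ⁴ ⟪v₀, v₃⟫ = 4c³ − 3cρ⁴`, and `dist r₀ r₃ ≥ 1` forces `c > 0`, i.e. `ρ² > 1/2`, i.e. `dist(r₀,r₂)² = 4 − 1/ρ² > 2`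
(`circle_chain_nonneg`). On the other hand `N, S, r₁, X` are all at distance `1` from `r₀` and `r₂`, so they lie on the
circle of squared radius `R² = 1 − dist(r₀,r₂)²/4` about the axis `r₀r₂`, with `N` touching `r₁` and `X`, and `r₁` touching
`N` and `S`; the same rule and `dist X S ≥ 1` force `R² ≥ 1/2`, i.e. `dist(r₀,r₂)² ≤ 2`. Contradiction.

HONEST FRAMING: elementary Euclidean geometry, [folklore]; this discharges the hypothesis `hB` of `EightCensusMinThree` /
`ContactNine`. Nothing about crystallization.
-/

noncomputable section

open Real RealInnerProductSpace

namespace Summit.Ventures.Crystal3D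

/-! ### 1. Lemmas on circles in `ℝ³` -/

/-- Squared distance as an inner product. [folklore] -/
theorem inner_self_eq_of_dist {x y : EuclideanSpace ℝ (Fin 3)} {d : ℝ} (h : dist x y = d) :
    ⟪x - y, x - y⟫ = d ^ 2 := by
  rw [real_inner_self_eq_norm_sq, ← dist_eq_norm, h]

/-- **Points at distance `1` from `A` and `B` lie on a circle:** `w = P − A − ½(B − A)` is orthogonal to `B − A` and
`⟪w, w⟫ = 1 − ⟪B − A, B − A⟫/4`. [folklore] -/
theorem circle_of_dist_eq_one {A B P : EuclideanSpace ℝ (Fin 3)} (hA : dist P A = 1) (hB : dist P B = 1) :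
    ⟪P - A - (1 / 2 : ℝ) • (B - A), B - A⟫ = 0 ∧
      ⟪P - A - (1 / 2 : ℝ) • (B - A), P - A - (1 / 2 : ℝ) • (B - A)⟫ = 1 - ⟪B - A, B - A⟫ / 4 := by
  have h1 : ⟪P - A, P - A⟫ = 1 := by rw [inner_self_eq_of_dist hA]; norm_num
  have h2 : ⟪P - B, P - B⟫ = 1 := by rw [inner_self_eq_of_dist hB]; norm_num
  have e : P - B = (P - A) - (B - A) := by abel
  rw [e, inner_sub_sub_self, real_inner_comm (P - A) (B - A)] at h2
  refine ⟨?_, ?_⟩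
  · rw [inner_sub_left, real_inner_smul_left]
    linarith
  · rw [inner_sub_sub_self, real_inner_smul_left, real_inner_smul_right, real_inner_smul_left,
      real_inner_smul_right, real_inner_comm (P - A) (B - A)]
    linarith

/-- Inner product of two vectors of equal squared length `R2` from the distance of their tips. [folklore] -/
theorem inner_eq_of_sub_eq {w w' x y : EuclideanSpace ℝ (Fin 3)} {R2 : ℝ} (h : x - y = w - w')
    (hw : ⟪w, w⟫ = R2) (hw' : ⟪w', w'⟫ = R2) : ⟪w, w'⟫ = R2 - dist x y ^ 2 / 2 := by
  have e : ⟪w - w', w - w'⟫ = dist x y ^ 2 := by rw [← h]; exact inner_self_eq_of_dist rfl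
  rw [inner_sub_sub_self, real_inner_comm w w', hw, hw'] at e
  linarith

/-- `⟪r • (a + b), z⟫ = r (⟪a, z⟫ + ⟪b, z⟫)`. [folklore] -/
theorem inner_smul_add_left' (r : ℝ) (a b z : EuclideanSpace ℝ (Fin 3)) :
    ⟪r • (a + b), z⟫ = r * (⟪a, z⟫ + ⟪b, z⟫) := by
  rw [real_inner_smul_left, inner_add_left]

/-- **The reflection rule on a circle.** Let `e ≠ 0` and let `p, a, b` be orthogonal to `e`, of the same squared length
`ρ2`, with `⟪a, p⟫ = ⟪b, p⟫ = c` and `a ≠ b`. Then `ρ2 • (a + b) = (2c) • p` (the two points of a circle at a given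
distance from `p` are mirror images in the diameter through `p`). Proof: `a, p, b ⊥ e` are linearly dependent.
[folklore] -/
theorem smul_add_eq_smul_of_circle {e p a b : EuclideanSpace ℝ (Fin 3)} {ρ2 c : ℝ} (he : e ≠ 0)
    (hpe : ⟪p, e⟫ = 0) (hae : ⟪a, e⟫ = 0) (hbe : ⟪b, e⟫ = 0) (hpp : ⟪p, p⟫ = ρ2) (haa : ⟪a, a⟫ = ρ2)
    (hbb : ⟪b, b⟫ = ρ2) (hap : ⟪a, p⟫ = c) (hbp : ⟪b, p⟫ = c) (hab : a ≠ b) :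
    ρ2 • (a + b) = (2 * c) • p := by
  have hρ : ρ2 ≠ 0 := by
    intro h0
    apply hab
    have ha0 : a = 0 := inner_self_eq_zero.1 (by rw [haa, h0])
    have hb0 : b = 0 := inner_self_eq_zero.1 (by rw [hbb, h0])
    rw [ha0, hb0]
  obtain ⟨α, β, γ, hne, hrel⟩ := exists_rel_of_orthogonal he hae hpe hbe
  have hpa : ⟪p, a⟫ = c := by rw [real_inner_comm]; exact hap
  have hpb : ⟪p, b⟫ = c := by rw [real_inner_comm]; exact hbp
  have hba : ⟪b, a⟫ = ⟪a, b⟫ := real_inner_comm _ _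
  have h1 := inner_rel_eq_zero (v := a) hrel
  have h2 := inner_rel_eq_zero (v := p) hrel
  have h3 := inner_rel_eq_zero (v := b) hrel
  rw [haa, hpa, hba] at h1
  rw [hap, hpp, hbp] at h2
  rw [hpb, hbb] at h3
  have hx : ⟪a, b⟫ ≠ ρ2 := by
    intro hx
    apply hab
    have h0 : ⟪a - b, a - b⟫ = 0 := by
      rw [inner_sub_sub_self, hba, haa, hbb, hx]; ring
    exact sub_eq_zero.1 (inner_self_eq_zero.1 h0)
  have hαγ : α = γ := by
    have e1 : (α - γ) * (ρ2 - ⟪a, b⟫) = 0 := by linear_combination h1 - h3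
    rcases mul_eq_zero.1 e1 with h | h
    · linarith
    · exact absurd (by linarith : ⟪a, b⟫ = ρ2) hx
  subst hαγ
  have hβ : ρ2 * β = -(2 * α * c) := by linarith
  have hα : α ≠ 0 := by
    intro h0
    rw [h0] at hβ
    have hb0 : β = 0 := by
      have : ρ2 * β = 0 := by rw [hβ]; ring
      exact (mul_eq_zero.1 this).resolve_left hρ
    rcases hne with h | h | h
    · exact h h0
    · exact h hb0
    · exact h h0
  have key : α • (ρ2 • (a + b) - (2 * c) • p) =
      ρ2 • (α • a + β • p + α • b) - (ρ2 * β + 2 * α * c) • p := by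
    module
  have hz : ρ2 * β + 2 * α * c = 0 := by rw [hβ]; ring
  rw [hrel, smul_zero, hz, zero_smul, sub_zero, smul_eq_zero] at key
  exact sub_eq_zero.1 (key.resolve_left hα)

/-- **The chain inequality.** The real-number core of both halves of the argument: with `c = ρ2 − 1/2`, from
`ρ2 (ρ2 + x₀₂) = 2c²`, `ρ2 (c + x₀₃) = 2c x₀₂` (two reflection steps), `x₀₃ ≤ c` (a separation) and `2ρ2 + 2c > 0`
(non-degeneracy) it follows that `c ≥ 0`. [folklore] -/
theorem circle_chain_nonneg {ρ2 x02 x03 : ℝ} (F1 : ρ2 * (ρ2 + x02) = 2 * (ρ2 - 1 / 2) * (ρ2 - 1 / 2))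
    (F2 : ρ2 * ((ρ2 - 1 / 2) + x03) = 2 * (ρ2 - 1 / 2) * x02) (F3 : x03 ≤ ρ2 - 1 / 2)
    (F5 : 0 < 2 * ρ2 + 2 * (ρ2 - 1 / 2)) : 0 ≤ ρ2 - 1 / 2 := by
  have G : ρ2 ^ 2 * x03 = 4 * (ρ2 - 1 / 2) ^ 3 - 3 * (ρ2 - 1 / 2) * ρ2 ^ 2 := by
    linear_combination ρ2 * F2 + 2 * (ρ2 - 1 / 2) * F1
  have H : 0 ≤ ρ2 ^ 2 * ((ρ2 - 1 / 2) - x03) := mul_nonneg (sq_nonneg _) (by linarith)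
  have P : 0 ≤ (ρ2 - 1 / 2) * ((ρ2 - 1 / 2) + ρ2) := by nlinarith [G, H]
  by_contra hc
  push Not at hc
  have : (ρ2 - 1 / 2) * ((ρ2 - 1 / 2) + ρ2) < 0 := mul_neg_of_neg_of_pos hc (by linarith)
  linarith

/-- Non-degeneracy on a circle: if `⟪a,a⟫ = ⟪p,p⟫ = ⟪b,b⟫ = ρ2`, `⟪a,p⟫ = ⟪b,p⟫ = ρ2 − 1/2` and `a ≠ b`, then
`2ρ2 + 2(ρ2 − 1/2) > 0` (otherwise `a = −p = b`). [folklore] -/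
theorem circle_nondeg {p a b : EuclideanSpace ℝ (Fin 3)} {ρ2 : ℝ} (hpp : ⟪p, p⟫ = ρ2) (haa : ⟪a, a⟫ = ρ2)
    (hbb : ⟪b, b⟫ = ρ2) (hap : ⟪a, p⟫ = ρ2 - 1 / 2) (hbp : ⟪b, p⟫ = ρ2 - 1 / 2) (hab : a ≠ b) :
    0 < 2 * ρ2 + 2 * (ρ2 - 1 / 2) := by
  have ha := real_inner_self_nonneg (x := a + p)
  rw [real_inner_add_add_self, haa, hap, hpp] at ha
  rcases (show 0 ≤ 2 * ρ2 + 2 * (ρ2 - 1 / 2) by linarith).lt_or_eq with h | h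
  · exact h
  · exfalso
    apply hab
    have h1 : ⟪a + p, a + p⟫ = 0 := by rw [real_inner_add_add_self, haa, hap, hpp]; linarith
    have h2 : ⟪b + p, b + p⟫ = 0 := by rw [real_inner_add_add_self, hbb, hbp, hpp]; linarith
    have e1 : a + p = 0 := inner_self_eq_zero.1 h1
    have e2 : b + p = 0 := inner_self_eq_zero.1 h2
    have : a = b := by
      have := sub_eq_zero.2 (e1.trans e2.symm)
      have e3 : a + p - (b + p) = a - b := by abel
      rw [e3] at this
      exact sub_eq_zero.1 this
    exact this

/-! ### 2. The pentagonal dipyramid with a cap -/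

/-- **Core statement.** Apexes `N, S`; ring `r₀ … r₄` (all touching `N` and `S`, consecutive ones touching — the contact
`r₄ r₀` is not needed); a ball `X` touching `N, r₀, r₂`; the displayed separations. Impossible. [folklore] -/
theorem no_dipyramid_cap {N S r0 r1 r2 r3 r4 X : EuclideanSpace ℝ (Fin 3)}
    (hN0 : dist r0 N = 1) (hN1 : dist r1 N = 1) (hN2 : dist r2 N = 1) (hN3 : dist r3 N = 1) (hN4 : dist r4 N = 1)
    (hS0 : dist r0 S = 1) (hS1 : dist r1 S = 1) (hS2 : dist r2 S = 1) (hS3 : dist r3 S = 1) (hS4 : dist r4 S = 1)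
    (h01 : dist r0 r1 = 1) (h12 : dist r1 r2 = 1) (h23 : dist r2 r3 = 1) (h34 : dist r3 r4 = 1)
    (hXN : dist X N = 1) (hX0 : dist X r0 = 1) (hX2 : dist X r2 = 1)
    (s02 : r0 ≠ r2) (s13 : r1 ≠ r3) (s24 : r2 ≠ r4) (s04 : r0 ≠ r4) (s03 : 1 ≤ dist r0 r3) (sNS : N ≠ S)
    (sX1 : r1 ≠ X) (sXS : 1 ≤ dist X S) : False := by
  -- ### Part A: the ring on the circle about the axis `NS`; conclusion `t := dist(r₀,r₂)² > 2`
  obtain ⟨u, hu⟩ : ∃ u : EuclideanSpace ℝ (Fin 3), u = S - N := ⟨_, rfl⟩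
  have hu0 : u ≠ 0 := by rw [hu]; exact sub_ne_zero.2 (Ne.symm sNS)
  have C0 := circle_of_dist_eq_one hN0 hS0
  have C1 := circle_of_dist_eq_one hN1 hS1
  have C2 := circle_of_dist_eq_one hN2 hS2
  have C3 := circle_of_dist_eq_one hN3 hS3
  have C4 := circle_of_dist_eq_one hN4 hS4
  rw [← hu] at C0 C1 C2 C3 C4
  obtain ⟨v0, hv0⟩ : ∃ v : EuclideanSpace ℝ (Fin 3), v = r0 - N - (1 / 2 : ℝ) • u := ⟨_, rfl⟩
  obtain ⟨v1, hv1⟩ : ∃ v : EuclideanSpace ℝ (Fin 3), v = r1 - N - (1 / 2 : ℝ) • u := ⟨_, rfl⟩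
  obtain ⟨v2, hv2⟩ : ∃ v : EuclideanSpace ℝ (Fin 3), v = r2 - N - (1 / 2 : ℝ) • u := ⟨_, rfl⟩
  obtain ⟨v3, hv3⟩ : ∃ v : EuclideanSpace ℝ (Fin 3), v = r3 - N - (1 / 2 : ℝ) • u := ⟨_, rfl⟩
  obtain ⟨v4, hv4⟩ : ∃ v : EuclideanSpace ℝ (Fin 3), v = r4 - N - (1 / 2 : ℝ) • u := ⟨_, rfl⟩
  rw [← hv0] at C0
  rw [← hv1] at C1
  rw [← hv2] at C2
  rw [← hv3] at C3
  rw [← hv4] at C4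
  obtain ⟨ρ2, hρ2⟩ : ∃ ρ : ℝ, ρ = 1 - ⟪u, u⟫ / 4 := ⟨_, rfl⟩
  rw [← hρ2] at C0 C1 C2 C3 C4
  obtain ⟨e0, n0⟩ := C0
  obtain ⟨e1, n1⟩ := C1
  obtain ⟨e2, n2⟩ := C2
  obtain ⟨e3, n3⟩ := C3
  obtain ⟨e4, n4⟩ := C4
  have d01 : r0 - r1 = v0 - v1 := by rw [hv0, hv1]; abel
  have d21 : r2 - r1 = v2 - v1 := by rw [hv2, hv1]; abel
  have d12 : r1 - r2 = v1 - v2 := by rw [hv1, hv2]; abel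
  have d32 : r3 - r2 = v3 - v2 := by rw [hv3, hv2]; abel
  have d23 : r2 - r3 = v2 - v3 := by rw [hv2, hv3]; abel
  have d43 : r4 - r3 = v4 - v3 := by rw [hv4, hv3]; abel
  have d02 : r0 - r2 = v0 - v2 := by rw [hv0, hv2]; abel
  have d03 : r0 - r3 = v0 - v3 := by rw [hv0, hv3]; abel
  have d13 : r1 - r3 = v1 - v3 := by rw [hv1, hv3]; abel
  have d24 : r2 - r4 = v2 - v4 := by rw [hv2, hv4]; abel
  have d04 : r0 - r4 = v0 - v4 := by rw [hv0, hv4]; abel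
  have h21 : dist r2 r1 = 1 := by rw [dist_comm]; exact h12
  have h32 : dist r3 r2 = 1 := by rw [dist_comm]; exact h23
  have h43 : dist r4 r3 = 1 := by rw [dist_comm]; exact h34
  have i01 : ⟪v0, v1⟫ = ρ2 - 1 / 2 := by
    have h := inner_eq_of_sub_eq d01 n0 n1; rw [h01] at h; linarith only [h]
  have i21 : ⟪v2, v1⟫ = ρ2 - 1 / 2 := by
    have h := inner_eq_of_sub_eq d21 n2 n1; rw [h21] at h; linarith only [h]
  have i12 : ⟪v1, v2⟫ = ρ2 - 1 / 2 := by
    have h := inner_eq_of_sub_eq d12 n1 n2; rw [h12] at h; linarith only [h]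
  have i32 : ⟪v3, v2⟫ = ρ2 - 1 / 2 := by
    have h := inner_eq_of_sub_eq d32 n3 n2; rw [h32] at h; linarith only [h]
  have i23 : ⟪v2, v3⟫ = ρ2 - 1 / 2 := by
    have h := inner_eq_of_sub_eq d23 n2 n3; rw [h23] at h; linarith only [h]
  have i43 : ⟪v4, v3⟫ = ρ2 - 1 / 2 := by
    have h := inner_eq_of_sub_eq d43 n4 n3; rw [h43] at h; linarith only [h]
  have i02 : ⟪v0, v2⟫ = ρ2 - dist r0 r2 ^ 2 / 2 := inner_eq_of_sub_eq d02 n0 n2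
  have i03 : ⟪v0, v3⟫ = ρ2 - dist r0 r3 ^ 2 / 2 := inner_eq_of_sub_eq d03 n0 n3
  have ne02 : v0 ≠ v2 := fun h => s02 (sub_eq_zero.1 (by rw [d02, h, sub_self]))
  have ne13 : v1 ≠ v3 := fun h => s13 (sub_eq_zero.1 (by rw [d13, h, sub_self]))
  have ne24 : v2 ≠ v4 := fun h => s24 (sub_eq_zero.1 (by rw [d24, h, sub_self]))
  have ne04 : v0 ≠ v4 := fun h => s04 (sub_eq_zero.1 (by rw [d04, h, sub_self]))
  -- reflection rule at `r₁`, `r₂`, `r₃`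
  have R1 := smul_add_eq_smul_of_circle hu0 e1 e0 e2 n1 n0 n2 i01 i21 ne02
  have R2 := smul_add_eq_smul_of_circle hu0 e2 e1 e3 n2 n1 n3 i12 i32 ne13
  have R3 := smul_add_eq_smul_of_circle hu0 e3 e2 e4 n3 n2 n4 i23 i43 ne24
  -- the chain inequality: `ρ2 > 1/2`
  have F1 : ρ2 * (ρ2 + ⟪v0, v2⟫) = 2 * (ρ2 - 1 / 2) * (ρ2 - 1 / 2) := by
    have q : ⟪ρ2 • (v0 + v2), v0⟫ = ⟪(2 * (ρ2 - 1 / 2)) • v1, v0⟫ := by rw [R1]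
    rw [inner_smul_add_left', real_inner_smul_left, n0, real_inner_comm v0 v2, real_inner_comm v0 v1, i01] at q
    linarith only [q]
  have F2 : ρ2 * ((ρ2 - 1 / 2) + ⟪v0, v3⟫) = 2 * (ρ2 - 1 / 2) * ⟪v0, v2⟫ := by
    have q : ⟪ρ2 • (v1 + v3), v0⟫ = ⟪(2 * (ρ2 - 1 / 2)) • v2, v0⟫ := by rw [R2]
    rw [inner_smul_add_left', real_inner_smul_left, real_inner_comm v0 v1, i01, real_inner_comm v0 v3,
      real_inner_comm v0 v2] at q
    linarith only [q]
  have sq03 : (1 : ℝ) ≤ dist r0 r3 ^ 2 := by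
    have h := s03
    calc (1 : ℝ) = 1 * 1 := by ring
      _ ≤ dist r0 r3 * dist r0 r3 := mul_le_mul h h zero_le_one (zero_le_one.trans h)
      _ = dist r0 r3 ^ 2 := by ring
  have F3 : ⟪v0, v3⟫ ≤ ρ2 - 1 / 2 := by
    rw [i03]
    linarith only [sq03]
  have F5 : 0 < 2 * ρ2 + 2 * (ρ2 - 1 / 2) := circle_nondeg n1 n0 n2 i01 i21 ne02
  have hc0 : 0 ≤ ρ2 - 1 / 2 := circle_chain_nonneg F1 F2 F3 F5
  have hρpos : 0 < ρ2 := by linarith only [hc0]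
  -- `c ≠ 0`: otherwise `v₀ = −v₂ = v₄`
  have hc : 0 < ρ2 - 1 / 2 := by
    rcases hc0.lt_or_eq with h | h
    · exact h
    · exfalso
      apply ne04
      rw [← h, mul_zero, zero_smul, smul_eq_zero] at R1 R3
      have a1 : v0 + v2 = 0 := R1.resolve_left hρpos.ne'
      have a3 : v2 + v4 = 0 := R3.resolve_left hρpos.ne'
      have e5 : v0 - v4 = (v0 + v2) - (v2 + v4) := by abel
      exact sub_eq_zero.1 (by rw [e5, a1, a3, sub_zero])
  -- `t = dist(r₀,r₂)² > 2`
  have ht : 2 < dist r0 r2 ^ 2 := by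
    rw [i02] at F1
    by_contra hle
    push Not at hle
    have hm : ρ2 * dist r0 r2 ^ 2 ≤ ρ2 * 2 := mul_le_mul_of_nonneg_left hle hρpos.le
    nlinarith only [F1, hm, hc]
  -- ### Part B: `N, S, r₁, X` on the circle about the axis `r₀ r₂`; conclusion `t ≤ 2`
  obtain ⟨u', hu'⟩ : ∃ u' : EuclideanSpace ℝ (Fin 3), u' = r2 - r0 := ⟨_, rfl⟩
  have hu'0 : u' ≠ 0 := by rw [hu']; exact sub_ne_zero.2 (Ne.symm s02)
  have hu'u' : ⟪u', u'⟫ = dist r0 r2 ^ 2 := by rw [hu', dist_comm]; exact inner_self_eq_of_dist rfl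
  have h0N : dist N r0 = 1 := by rw [dist_comm]; exact hN0
  have h2N : dist N r2 = 1 := by rw [dist_comm]; exact hN2
  have h0S : dist S r0 = 1 := by rw [dist_comm]; exact hS0
  have h2S : dist S r2 = 1 := by rw [dist_comm]; exact hS2
  have h10 : dist r1 r0 = 1 := by rw [dist_comm]; exact h01
  have DN := circle_of_dist_eq_one h0N h2N
  have DS := circle_of_dist_eq_one h0S h2S
  have D1 := circle_of_dist_eq_one h10 h12
  have DX := circle_of_dist_eq_one hX0 hX2
  rw [← hu'] at DN DS D1 DX
  obtain ⟨wN, hwN⟩ : ∃ w : EuclideanSpace ℝ (Fin 3), w = N - r0 - (1 / 2 : ℝ) • u' := ⟨_, rfl⟩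
  obtain ⟨wS, hwS⟩ : ∃ w : EuclideanSpace ℝ (Fin 3), w = S - r0 - (1 / 2 : ℝ) • u' := ⟨_, rfl⟩
  obtain ⟨w1, hw1⟩ : ∃ w : EuclideanSpace ℝ (Fin 3), w = r1 - r0 - (1 / 2 : ℝ) • u' := ⟨_, rfl⟩
  obtain ⟨wX, hwX⟩ : ∃ w : EuclideanSpace ℝ (Fin 3), w = X - r0 - (1 / 2 : ℝ) • u' := ⟨_, rfl⟩
  rw [← hwN] at DN
  rw [← hwS] at DS
  rw [← hw1] at D1
  rw [← hwX] at DX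
  obtain ⟨R2, hR2⟩ : ∃ R : ℝ, R = 1 - ⟪u', u'⟫ / 4 := ⟨_, rfl⟩
  rw [← hR2] at DN DS D1 DX
  obtain ⟨fN, mN⟩ := DN
  obtain ⟨fS, mS⟩ := DS
  obtain ⟨f1, m1⟩ := D1
  obtain ⟨fX, mX⟩ := DX
  have g1N : r1 - N = w1 - wN := by rw [hw1, hwN]; abel
  have gXN : X - N = wX - wN := by rw [hwX, hwN]; abel
  have gN1 : N - r1 = wN - w1 := by rw [hwN, hw1]; abel
  have gS1 : S - r1 = wS - w1 := by rw [hwS, hw1]; abel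
  have g1S : r1 - S = w1 - wS := by rw [hw1, hwS]; abel
  have gNS : N - S = wN - wS := by rw [hwN, hwS]; abel
  have gXS : X - S = wX - wS := by rw [hwX, hwS]; abel
  have g1X : r1 - X = w1 - wX := by rw [hw1, hwX]; abel
  have hN1' : dist N r1 = 1 := by rw [dist_comm]; exact hN1
  have hS1' : dist S r1 = 1 := by rw [dist_comm]; exact hS1
  have j1N : ⟪w1, wN⟫ = R2 - 1 / 2 := by
    have h := inner_eq_of_sub_eq g1N m1 mN; rw [hN1] at h; linarith only [h]
  have jXN : ⟪wX, wN⟫ = R2 - 1 / 2 := by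
    have h := inner_eq_of_sub_eq gXN mX mN; rw [hXN] at h; linarith only [h]
  have jN1 : ⟪wN, w1⟫ = R2 - 1 / 2 := by
    have h := inner_eq_of_sub_eq gN1 mN m1; rw [hN1'] at h; linarith only [h]
  have jS1 : ⟪wS, w1⟫ = R2 - 1 / 2 := by
    have h := inner_eq_of_sub_eq gS1 mS m1; rw [hS1'] at h; linarith only [h]
  have j1S : ⟪w1, wS⟫ = R2 - 1 / 2 := by
    have h := inner_eq_of_sub_eq g1S m1 mS; rw [hS1] at h; linarith only [h]
  have jNS : ⟪wN, wS⟫ = R2 - dist N S ^ 2 / 2 := inner_eq_of_sub_eq gNS mN mS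
  have jXS : ⟪wX, wS⟫ = R2 - dist X S ^ 2 / 2 := inner_eq_of_sub_eq gXS mX mS
  have ne1X : w1 ≠ wX := fun h => sX1 (sub_eq_zero.1 (by rw [g1X, h, sub_self]))
  have neNS : wN ≠ wS := fun h => sNS (sub_eq_zero.1 (by rw [gNS, h, sub_self]))
  -- reflection rule at `N` (neighbours `r₁`, `X`) and at `r₁` (neighbours `N`, `S`)
  have G1 := smul_add_eq_smul_of_circle hu'0 fN f1 fX mN m1 mX j1N jXN ne1X
  have G2 := smul_add_eq_smul_of_circle hu'0 f1 fN fS m1 mN mS jN1 jS1 neNS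
  have F1' : R2 * (R2 + ⟪wN, wS⟫) = 2 * (R2 - 1 / 2) * (R2 - 1 / 2) := by
    have q : ⟪R2 • (wN + wS), wN⟫ = ⟪(2 * (R2 - 1 / 2)) • w1, wN⟫ := by rw [G2]
    rw [inner_smul_add_left', real_inner_smul_left, mN, real_inner_comm wN wS, j1N] at q
    linarith only [q]
  have F2' : R2 * ((R2 - 1 / 2) + ⟪wX, wS⟫) = 2 * (R2 - 1 / 2) * ⟪wN, wS⟫ := by
    have q : ⟪R2 • (w1 + wX), wS⟫ = ⟪(2 * (R2 - 1 / 2)) • wN, wS⟫ := by rw [G1]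
    rw [inner_smul_add_left', real_inner_smul_left, j1S] at q
    linarith only [q]
  have sqXS : (1 : ℝ) ≤ dist X S ^ 2 := by
    have h := sXS
    calc (1 : ℝ) = 1 * 1 := by ring
      _ ≤ dist X S * dist X S := mul_le_mul h h zero_le_one (zero_le_one.trans h)
      _ = dist X S ^ 2 := by ring
  have F3' : ⟪wX, wS⟫ ≤ R2 - 1 / 2 := by
    rw [jXS]
    linarith only [sqXS]
  have F5' : 0 < 2 * R2 + 2 * (R2 - 1 / 2) := circle_nondeg mN m1 mX j1N jXN ne1X
  have hc' : 0 ≤ R2 - 1 / 2 := circle_chain_nonneg F1' F2' F3' F5'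
  -- `R2 = 1 − t/4 ≥ 1/2` contradicts `t > 2`
  rw [hR2, hu'u'] at hc'
  linarith only [hc', ht]

/-! ### 3. The pattern `Open8B` -/

/-- **`Open8B` is not realisable** (graph6 `GCxu~w`; labels of `ObstructionPatterns.Open8BEdges`: apexes `7, 2`, ring
`3, 4, 6, 1, 0`, cap `5` touching `7, 3, 6`). [folklore] -/
theorem no_Open8B (p : Fin 8 → EuclideanSpace ℝ (Fin 3))
    (hE : ∀ e ∈ Open8BEdges, dist (p e.1) (p e.2) = 1) (hN : ∀ i j : Fin 8, i ≠ j → 1 ≤ dist (p i) (p j)) :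
    False := by
  have c : ∀ i j : Fin 8, (i, j) ∈ Open8BEdges → dist (p j) (p i) = 1 := fun i j h => by
    rw [dist_comm]; exact hE (i, j) h
  have c' : ∀ i j : Fin 8, (i, j) ∈ Open8BEdges → dist (p i) (p j) = 1 := fun i j h => hE (i, j) h
  have ne : ∀ i j : Fin 8, i ≠ j → p i ≠ p j := fun i j h hp => by
    have := hN i j h; rw [hp, dist_self] at this; linarith
  exact no_dipyramid_cap (N := p 7) (S := p 2) (r0 := p 3) (r1 := p 4) (r2 := p 6) (r3 := p 1) (r4 := p 0)
    (X := p 5)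
    (c' 3 7 (by decide)) (c' 4 7 (by decide)) (c' 6 7 (by decide)) (c' 1 7 (by decide)) (c' 0 7 (by decide))
    (c 2 3 (by decide)) (c 2 4 (by decide)) (c 2 6 (by decide)) (c' 1 2 (by decide)) (c' 0 2 (by decide))
    (c' 3 4 (by decide)) (c' 4 6 (by decide)) (c 1 6 (by decide)) (c 0 1 (by decide))
    (c' 5 7 (by decide)) (c 3 5 (by decide)) (c' 5 6 (by decide))
    (ne 3 6 (by decide)) (ne 4 1 (by decide)) (ne 6 0 (by decide)) (ne 3 0 (by decide))
    (hN 3 1 (by decide)) (ne 7 2 (by decide))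
    (ne 4 5 (by decide)) (hN 5 2 (by decide))

end Summit.Ventures.Crystal3D

end
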